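import Summits.Schanuel.Schanuel.Theorems.ZilberEacRotatingPower
import Summits.Schanuel.Schanuel.Theorems.ZilberEacEquivariantDirectionExistence
import Summits.Schanuel.Schanuel.Theorems.ZilberEacRealHyperplaneInvariant
import HarnessLib

/-!
# Bases equivariant under a lattice direction with IRRATIONAL drift: Zariski density (O53 (b), part)

Zilber's Exponential-Algebraic Closedness, case ladder (host summit Schanuel, cell `pub-schanuel`,
seat 2, gen 12).  THE FAMILY: a base `g ∈ ℂ[x₀..x_s]` EQUIVARIANT under a lattice direction `q`,
`g(x + zq) = g(x) + βz` with `β ∈ ℝ ∖ ℚ`, targets `Aⱼ` with `(Aⱼ)_{dⱼ}(2πiq) ≠ 0` and degrees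
`dⱼ = λqⱼ`, fibre polynomials `fⱼ ∈ ℂ[u]` in the slow regime `βλ + max(βλ,0) deg fⱼ < dⱼ`:

  `W = polyFibredGraph g A (fⱼ(u)) = {x_{s+1} = g(x), yⱼ = Aⱼ(x) + y_{s+1} fⱼ(y_{s+1})}`.

O51 (b) / O53 (b) recorded "degenerate balance directions over NON-invariant bases
(`x₂ = -(x₀-x₁)² + x₀`)" as open: along the `(1,1)`-families the power coordinate `w = e^{g}` has
POLYNOMIAL size, "neither bounded (L) nor super-polynomial (J′/K′) nor of irrational exponent (J)".
When the drift coefficient `β` is irrational the phase of `w` ROTATES non-periodically and THEOREM M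
(`ZilberEacRotatingPower`) eliminates:

**THEOREM (`unprojectedDense_polyFibredGraph_equivariantDirection`).**  Under the hypotheses above,
`I(W ∩ Γ_exp) = I(W)`.

Proof: `exists_solutions_equivariantDirection` gives, for every label `p`, solutions
`x(m) = r(m) + (2πi m + λ log m) q`, `r(m) → 2πi p + log a`, with
`e^{g(x(m))} = e^{g(r(m))} · m^{βλ} · (e^{2πiβ})^m`; THEOREM M with `ζ = e^{2πiβ}` (not a root of unity
since `β ∉ ℚ`) and the plain density of the labels `2πiℤ^{s+1} + log a`.

Corollaries: `polyFibredGraph_equivariantDirection_member_dense` (`A` dominant, `deg g ≥ 2`: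
certified members of `EC(s+2, s+1)`), and the example **`negSqDiffShift_member_dense`**:
`{x₂ = -(x₀ - x₁)² + (√2/4) x₀, y₀ = x₀ + y₂, y₁ = x₁ + y₂} ⊆ ℂ³ × ℂ³` — no negative lattice ray, not
oscillatory of negative second order, degenerate balance direction `g_D(1,1) = 0`, NOT invariant under
`(1,1)` — is a certified member of `EC(3,2)`, not linearly split, meets `Γ_exp`, DENSE.

HONEST FRAMING: explicit families inside an OPEN cell; the literal O53 (b) example (`β = 1`: rational
drift AND critical size) stays open; `EC(3,2)` OPEN; NOT Schanuel's conjecture; EAC ⇏ SC.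
-/

noncomputable section

open Complex MvPolynomial Filter Topology
open Literature.NumberTheory.Transcendental Literature.ModelTheory.Zilber
  Literature.ModelTheory.ExponentialFields

set_option linter.dupNamespace false

namespace Summit.Schanuel.Schanuel.Theorems

/-! ## Part A. Density over equivariant bases with irrational drift -/

section Density

variable {s : ℕ}

/-- **THEOREM (Zariski density over an equivariant base with irrational drift, slow regime).**  See
the module docstring. (new) [cite: MantovaMasser2023, §1 p.5 (the open case dim π(V) = 2 in ℂ³×ℂˣ³)] -/
theorem unprojectedDense_polyFibredGraph_equivariantDirection (g : MvPolynomial (Fin (s + 1)) ℂ)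
    (q : Fin (s + 1) → ℤ) (β : ℝ) (hβ : Irrational β)
    (hequiv : ∀ (x : Fin (s + 1) → ℂ) (z : ℂ),
      eval (x + z • fun j => (q j : ℂ)) g = eval x g + (β : ℂ) * z)
    (A : Fin (s + 1) → MvPolynomial (Fin (s + 1)) ℂ)
    (hA : ∀ j, eval (fun i => 2 * Real.pi * I * (q i : ℂ))
      (homogeneousComponent (A j).totalDegree (A j)) ≠ 0)
    (lam : ℝ) (hlam : ∀ j, ((A j).totalDegree : ℝ) = lam * (q j : ℝ)) (f : Fin (s + 1) → Polynomial ℂ)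
    (hslow : ∀ j, β * lam + max (β * lam) 0 * ((f j).natDegree : ℝ) < (A j).totalDegree) :
    UnprojectedDense (polyFibredGraph g A (fun j => (f j).toMvPolynomial 0)) := by
  classical
  set ζ : ℂ := exp (2 * Real.pi * I * (β : ℂ)) with hζ
  have hζ1 : ‖ζ‖ = 1 := by
    rw [hζ, show (2 * Real.pi * I * (β : ℂ)) = ((2 * Real.pi * β : ℝ) : ℂ) * I by push_cast; ring]
    exact Complex.norm_exp_ofReal_mul_I _
  have hroot : ∀ j : ℕ, 0 < j → ζ ^ j ≠ 1 := exp_two_pi_I_mul_pow_ne_one hβ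
  set Llog : Fin (s + 1) → ℂ := fun j => log (eval (fun i => 2 * Real.pi * I * (q i : ℂ))
    (homogeneousComponent (A j).totalDegree (A j))) with hLlog
  refine unprojectedDense_of_rotating_power (t := s + 1)
    (isIrreducibleClosed_polyFibredGraph g A _) (by rw [zariskiDim_polyFibredGraph])
    (fun i => Sum.inl (Fin.castSucc i)) (Sum.inr (Fin.last (s + 1)))
    (fun j => (lam : ℂ) * (q j : ℂ)) (fun j => (q j : ℂ)) (β * lam) hζ1 hroot
    (U := {ρ | ∃ p : Fin (s + 1) → ℤ, ρ = fun j => 2 * Real.pi * I * (p j : ℂ) + Llog j})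
    (fun G hG => ?_) ?_
  · obtain ⟨pv, hpv⟩ := exists_int_eval_translate_ne_zero hG Llog (a := 2 * Real.pi * I)
      Complex.two_pi_I_ne_zero
    refine ⟨_, ⟨pv, rfl⟩, ?_⟩
    have e : (fun j => 2 * Real.pi * I * (pv j : ℂ) + Llog j) =
        fun i => Llog i + 2 * Real.pi * I * (pv i : ℂ) := by
      funext i; ring
    rwa [e]
  rintro ρ₀ ⟨p, rfl⟩
  obtain ⟨x, r, hsol, hx, hgx, hr⟩ :=
    exists_solutions_equivariantDirection g q β hequiv A hA lam hlam f hslow p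
  set P : ℕ → Fin (s + 2) ⊕ Fin (s + 2) → ℂ := fun m =>
    pgParam g A (fun j => (f j).toMvPolynomial 0) (x m) (exp (eval (x m) g)) with hP
  have hexpm : ∀ m : ℕ, 1 ≤ m → exp (((Real.log m : ℝ)) : ℂ) = (m : ℂ) := by
    intro m hm
    rw [← Complex.ofReal_exp, Real.exp_log (by exact_mod_cast hm)]
    push_cast
    rfl
  refine ⟨P, fun m => r m + ((lam : ℂ) * log (m : ℂ)) • (fun j => (q j : ℂ)), fun m => Real.log m,
    fun m => 2 * Real.pi * I * (m : ℂ),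
    fun m => 2 * Real.pi * I * (m : ℂ) / exp (((Real.log m : ℝ)) : ℂ),
    fun m => exp (eval (r m) g), 2 * Real.pi * I,
    exp (eval (fun j => 2 * Real.pi * I * (p j : ℂ) + Llog j) g),
    ?_, ?_, ?_, ?_, fun m => ?_, ?_, Complex.two_pi_I_ne_zero, ?_, ?_, Complex.exp_ne_zero _⟩
  · -- points of `W ∩ Γ_exp`
    filter_upwards [hsol] with m hm
    refine ⟨pgParam_mem g A _ _ _, pgParam_mem_expGraph_of_solution g A _ fun j => ?_⟩
    rw [hm j, MvPolynomial.eval_toMvPolynomial, Fin.cons_zero]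
  · -- the `x`-coordinates: `x(m) = (r(m) + λ log m q) + 2πi m q`
    filter_upwards with m
    have hcoord : (fun i => P m (Sum.inl (Fin.castSucc i))) = x m := by
      funext i; simp [hP]
    rw [hcoord, hx m, add_smul, add_assoc, add_comm ((2 * Real.pi * I * (m : ℂ)) • _)]
  · exact Real.tendsto_log_atTop.comp tendsto_natCast_atTop_atTop
  · -- the transversal part converges
    refine hr.congr fun m => ?_
    dsimp only
    rw [← Complex.natCast_log]
    have : ((lam : ℂ) * ((Real.log m : ℝ) : ℂ)) • (fun j => (q j : ℂ)) -
        ((Real.log m : ℝ) : ℂ) • (fun j => (lam : ℂ) * (q j : ℂ)) = 0 := by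
      funext j; simp only [Pi.sub_apply, Pi.smul_apply, smul_eq_mul, Pi.zero_apply]; ring
    rw [add_sub_assoc, this, add_zero]
  · rw [mul_div_cancel₀ _ (Complex.exp_ne_zero _)]
  · -- `Y(m) = 2πi` eventually
    refine tendsto_const_nhds.congr' ?_
    filter_upwards [eventually_ge_atTop 1] with m hm
    rw [hexpm m hm, mul_div_cancel_right₀ _ (by exact_mod_cast (show m ≠ 0 by omega))]
  · -- the power coordinate `e^{g(x(m))} = m^{βλ} ζ^m e^{g(r(m))}`
    filter_upwards with m
    have hβc : P m (Sum.inr (Fin.last (s + 1))) = exp (eval (x m) g) := by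
      simp [hP]
    rw [hβc, hgx m, hζ, ← Complex.exp_nat_mul, ← Complex.exp_add, ← Complex.exp_add,
      ← Complex.natCast_log]
    congr 1
    push_cast
    ring
  · -- `C(m) = e^{g(r(m))} → e^{g(r_p)}`
    exact ((Complex.continuous_exp.comp (MvPolynomial.continuous_eval g)).tendsto _).comp hr

/-- **Certified members with dense exponential points over an equivariant base.**  `A` dominant,
`deg g ≥ 2`, the hypotheses of the theorem: all seven hypotheses of `ECCell (s+2) (s+1)`, not linearly
split, `W ∩ Γ_exp ≠ ∅`, `I(W ∩ Γ_exp) = I(W)`. (new)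
[cite: MantovaMasser2023, §1 p.5 (the open case dim π(V) = 2 in ℂ³×ℂˣ³)] -/
theorem polyFibredGraph_equivariantDirection_member_dense (g : MvPolynomial (Fin (s + 1)) ℂ)
    (hD : 2 ≤ g.totalDegree) (q : Fin (s + 1) → ℤ) (β : ℝ) (hβ : Irrational β)
    (hequiv : ∀ (x : Fin (s + 1) → ℂ) (z : ℂ),
      eval (x + z • fun j => (q j : ℂ)) g = eval x g + (β : ℂ) * z)
    (A : Fin (s + 1) → MvPolynomial (Fin (s + 1)) ℂ)
    (hAinj : Function.Injective
      (aeval A : MvPolynomial (Fin (s + 1)) ℂ →ₐ[ℂ] MvPolynomial (Fin (s + 1)) ℂ))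
    (hA : ∀ j, eval (fun i => 2 * Real.pi * I * (q i : ℂ))
      (homogeneousComponent (A j).totalDegree (A j)) ≠ 0)
    (lam : ℝ) (hlam : ∀ j, ((A j).totalDegree : ℝ) = lam * (q j : ℝ)) (f : Fin (s + 1) → Polynomial ℂ)
    (hslow : ∀ j, β * lam + max (β * lam) 0 * ((f j).natDegree : ℝ) < (A j).totalDegree) :
    (IsIrreducibleClosed ℂ (polyFibredGraph g A (fun j => (f j).toMvPolynomial 0)) ∧
      (polyFibredGraph g A (fun j => (f j).toMvPolynomial 0) ∩ torusLocus ℂ (s + 2)).Nonempty ∧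
      IsRotund ℂ (s + 2) (polyFibredGraph g A (fun j => (f j).toMvPolynomial 0) ∩
        torusLocus ℂ (s + 2)) ∧
      IsAddFree ℂ (s + 2) (polyFibredGraph g A (fun j => (f j).toMvPolynomial 0) ∩
        torusLocus ℂ (s + 2)) ∧
      IsMulFree ℂ (s + 2) (polyFibredGraph g A (fun j => (f j).toMvPolynomial 0) ∩
        torusLocus ℂ (s + 2)) ∧
      zariskiDim ℂ (polyFibredGraph g A (fun j => (f j).toMvPolynomial 0)) = (s + 2 : ℕ) ∧
      addProjDim ℂ (s + 2) (polyFibredGraph g A (fun j => (f j).toMvPolynomial 0)) = (s + 1 : ℕ)) ∧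
    ¬ IsLinearSplit ℂ (s + 2) (polyFibredGraph g A (fun j => (f j).toMvPolynomial 0)) ∧
    (polyFibredGraph g A (fun j => (f j).toMvPolynomial 0) ∩ expGraph ℂ (s + 2)).Nonempty ∧
    UnprojectedDense (polyFibredGraph g A (fun j => (f j).toMvPolynomial 0)) := by
  have hcell := ecCell_hypotheses_polyFibredGraph g A (fun j => (f j).toMvPolynomial 0) hAinj hD
  have hdense := unprojectedDense_polyFibredGraph_equivariantDirection g q β hβ hequiv A hA lam hlam
    f hslow
  refine ⟨hcell, not_isLinearSplit_polyFibredGraph g A _ (Nat.succ_pos s) hAinj, ?_, hdense⟩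
  obtain ⟨w, hw, -⟩ := hcell.2.1
  exact inter_expGraph_nonempty_of_vanishingIdeal_eq ⟨w, hw⟩ hdense

end Density

/-! ## Part B. The example: `x₂ = -(x₀ - x₁)² + (√2/4) x₀`, `yⱼ = xⱼ + y₂` -/

section Example

/-- Data of the base `g = -(X₀ - X₁)² + (√2/4) X₀`: degree `2`; EQUIVARIANT under `q = (1,1)` with
irrational drift `β = √2/4` (`g(x + z(1,1)) = g(x) + (√2/4) z`), hence not invariant; leading form
`-(X₀ - X₁)²` with `g_D(1,1) = 0` (degenerate balance direction) and `Re g_D(2πiℓ) = 4π²(ℓ₀-ℓ₁)² ≥ 0`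
for every lattice direction (no negative ray). (new)
[cite: MantovaMasser2023, §1 p.5 (the open case dim π(V) = 2 in ℂ³×ℂˣ³)] -/
theorem negSqDiffShift_data :
    (-(X 0 - X 1) ^ 2 + C ((Real.sqrt 2 / 4 : ℝ) : ℂ) * X 0 : MvPolynomial (Fin 2) ℂ).totalDegree = 2 ∧
    (∀ (x : Fin 2 → ℂ) (z : ℂ), eval (x + z • fun j => ((![1, 1] : Fin 2 → ℤ) j : ℂ))
        (-(X 0 - X 1) ^ 2 + C ((Real.sqrt 2 / 4 : ℝ) : ℂ) * X 0 : MvPolynomial (Fin 2) ℂ) =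
      eval x (-(X 0 - X 1) ^ 2 + C ((Real.sqrt 2 / 4 : ℝ) : ℂ) * X 0 : MvPolynomial (Fin 2) ℂ) +
        ((Real.sqrt 2 / 4 : ℝ) : ℂ) * z) ∧
    (∀ ℓ : Fin 2 → ℤ, 0 ≤ (eval (fun i => 2 * Real.pi * I * (ℓ i : ℂ))
      (-(X 0 - X 1) ^ 2 : MvPolynomial (Fin 2) ℂ)).re) ∧
    eval (fun _ => (1 : ℂ)) (-(X 0 - X 1) ^ 2 : MvPolynomial (Fin 2) ℂ) = 0 := by
  refine ⟨?_, fun x z => ?_, fun ℓ => ?_, by simp⟩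
  · -- total degree
    have hsq : ((X 0 - X 1) ^ 2 : MvPolynomial (Fin 2) ℂ).IsHomogeneous 2 :=
      ((isHomogeneous_X ℂ 0).sub (isHomogeneous_X ℂ 1)).pow 2
    have hsq0 : ((X 0 - X 1) ^ 2 : MvPolynomial (Fin 2) ℂ) ≠ 0 := by
      intro h
      have := congrArg (eval ![1, 0]) h
      simp at this
    have hdeg2 : (-(X 0 - X 1) ^ 2 : MvPolynomial (Fin 2) ℂ).totalDegree = 2 := by
      rw [totalDegree_neg]; exact hsq.totalDegree hsq0
    have hdeg1 : (C ((Real.sqrt 2 / 4 : ℝ) : ℂ) * X 0 : MvPolynomial (Fin 2) ℂ).totalDegree ≤ 1 :=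
      (totalDegree_mul _ _).trans (by rw [totalDegree_C, totalDegree_X, zero_add])
    apply le_antisymm
    · exact (totalDegree_add _ _).trans (max_le hdeg2.le (hdeg1.trans (by norm_num)))
    · -- the coefficient of `X₀²` is `-1 ≠ 0`... via homogeneous components: evaluate the degree-2 part
      by_contra hlt
      push Not at hlt
      have hlt' : (-(X 0 - X 1) ^ 2 + C ((Real.sqrt 2 / 4 : ℝ) : ℂ) * X 0 :
          MvPolynomial (Fin 2) ℂ).totalDegree < 2 := hlt
      have h2 := homogeneousComponent_eq_zero _ _ hlt'
      rw [map_add, homogeneousComponent_of_mem (hsq.neg) , if_pos rfl,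
        homogeneousComponent_eq_zero _ _ (hdeg1.trans_lt (by norm_num)), add_zero, neg_eq_zero] at h2
      exact hsq0 h2
  · simp only [map_add, map_neg, map_pow, map_sub, map_mul, eval_C, eval_X, Pi.add_apply,
      Pi.smul_apply, smul_eq_mul]
    simp
    ring
  · have : eval (fun i => 2 * Real.pi * I * (ℓ i : ℂ)) (-(X 0 - X 1) ^ 2 : MvPolynomial (Fin 2) ℂ) =
        (((4 * Real.pi ^ 2 * ((ℓ 0 : ℝ) - (ℓ 1 : ℝ)) ^ 2 : ℝ)) : ℂ) := by
      simp only [map_neg, map_pow, map_sub, eval_X]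
      push_cast
      have hI : I ^ 2 = -1 := Complex.I_sq
      linear_combination (-(2 * Real.pi * ((ℓ 0 : ℂ) - (ℓ 1 : ℂ))) ^ 2) * hI
    rw [this, Complex.ofReal_re]
    positivity

/-- **The equivariant example is dense.**
`W = {x₂ = -(x₀ - x₁)² + (√2/4) x₀, y₀ = x₀ + y₂, y₁ = x₁ + y₂} ⊆ ℂ³ × ℂ³`
(`e^z = z + e^{-(z-w)² + √2z/4}`, `e^w = w + e^{-(z-w)² + √2z/4}`): all seven hypotheses of `ECCell 3 2`,
not linearly split, `W ∩ Γ_exp ≠ ∅` AND `I(W ∩ Γ_exp) = I(W)`. (new)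
[cite: MantovaMasser2023, §1 p.5 (the open case dim π(V) = 2 in ℂ³×ℂˣ³)] -/
theorem negSqDiffShift_member_dense :
    (IsIrreducibleClosed ℂ (polyFibredGraph
        (-(X 0 - X 1) ^ 2 + C ((Real.sqrt 2 / 4 : ℝ) : ℂ) * X 0 : MvPolynomial (Fin 2) ℂ)
        (fun j => X j) (fun _ => (1 : Polynomial ℂ).toMvPolynomial 0)) ∧
      (polyFibredGraph (-(X 0 - X 1) ^ 2 + C ((Real.sqrt 2 / 4 : ℝ) : ℂ) * X 0 : MvPolynomial (Fin 2) ℂ)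
          (fun j => X j) (fun _ => (1 : Polynomial ℂ).toMvPolynomial 0) ∩ torusLocus ℂ 3).Nonempty ∧
      IsRotund ℂ 3 (polyFibredGraph
          (-(X 0 - X 1) ^ 2 + C ((Real.sqrt 2 / 4 : ℝ) : ℂ) * X 0 : MvPolynomial (Fin 2) ℂ)
          (fun j => X j) (fun _ => (1 : Polynomial ℂ).toMvPolynomial 0) ∩ torusLocus ℂ 3) ∧
      IsAddFree ℂ 3 (polyFibredGraph
          (-(X 0 - X 1) ^ 2 + C ((Real.sqrt 2 / 4 : ℝ) : ℂ) * X 0 : MvPolynomial (Fin 2) ℂ)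
          (fun j => X j) (fun _ => (1 : Polynomial ℂ).toMvPolynomial 0) ∩ torusLocus ℂ 3) ∧
      IsMulFree ℂ 3 (polyFibredGraph
          (-(X 0 - X 1) ^ 2 + C ((Real.sqrt 2 / 4 : ℝ) : ℂ) * X 0 : MvPolynomial (Fin 2) ℂ)
          (fun j => X j) (fun _ => (1 : Polynomial ℂ).toMvPolynomial 0) ∩ torusLocus ℂ 3) ∧
      zariskiDim ℂ (polyFibredGraph
          (-(X 0 - X 1) ^ 2 + C ((Real.sqrt 2 / 4 : ℝ) : ℂ) * X 0 : MvPolynomial (Fin 2) ℂ)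
          (fun j => X j) (fun _ => (1 : Polynomial ℂ).toMvPolynomial 0)) = (3 : ℕ) ∧
      addProjDim ℂ 3 (polyFibredGraph
          (-(X 0 - X 1) ^ 2 + C ((Real.sqrt 2 / 4 : ℝ) : ℂ) * X 0 : MvPolynomial (Fin 2) ℂ)
          (fun j => X j) (fun _ => (1 : Polynomial ℂ).toMvPolynomial 0)) = (2 : ℕ)) ∧
    ¬ IsLinearSplit ℂ 3 (polyFibredGraph
        (-(X 0 - X 1) ^ 2 + C ((Real.sqrt 2 / 4 : ℝ) : ℂ) * X 0 : MvPolynomial (Fin 2) ℂ)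
        (fun j => X j) (fun _ => (1 : Polynomial ℂ).toMvPolynomial 0)) ∧
    (polyFibredGraph (-(X 0 - X 1) ^ 2 + C ((Real.sqrt 2 / 4 : ℝ) : ℂ) * X 0 : MvPolynomial (Fin 2) ℂ)
        (fun j => X j) (fun _ => (1 : Polynomial ℂ).toMvPolynomial 0) ∩ expGraph ℂ 3).Nonempty ∧
    UnprojectedDense (polyFibredGraph
        (-(X 0 - X 1) ^ 2 + C ((Real.sqrt 2 / 4 : ℝ) : ℂ) * X 0 : MvPolynomial (Fin 2) ℂ)
        (fun j => X j) (fun _ => (1 : Polynomial ℂ).toMvPolynomial 0)) := by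
  obtain ⟨hdeg, hequiv, -, -⟩ := negSqDiffShift_data
  have hAinj : Function.Injective (aeval (fun j : Fin 2 => (X j : MvPolynomial (Fin 2) ℂ)) :
      MvPolynomial (Fin 2) ℂ →ₐ[ℂ] MvPolynomial (Fin 2) ℂ) := by
    rw [aeval_X_left]; exact fun _ _ h => h
  have hlead : ∀ j : Fin 2, homogeneousComponent (X j : MvPolynomial (Fin 2) ℂ).totalDegree
      (X j : MvPolynomial (Fin 2) ℂ) = X j := fun j => by
    rw [totalDegree_X, homogeneousComponent_eq_self (isHomogeneous_X ℂ j)]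
  have hA : ∀ j : Fin 2, eval (fun i => 2 * Real.pi * I * ((![1, 1] : Fin 2 → ℤ) i : ℂ))
      (homogeneousComponent (X j : MvPolynomial (Fin 2) ℂ).totalDegree
        (X j : MvPolynomial (Fin 2) ℂ)) ≠ 0 := by
    intro j
    rw [hlead j, eval_X]
    fin_cases j <;> simp [Real.pi_ne_zero, Complex.I_ne_zero]
  have hlam : ∀ j : Fin 2, ((X j : MvPolynomial (Fin 2) ℂ).totalDegree : ℝ) =
      (1 : ℝ) * (((![1, 1] : Fin 2 → ℤ) j : ℤ) : ℝ) := by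
    intro j
    rw [totalDegree_X]
    fin_cases j <;> simp
  have hs2 : Real.sqrt 2 < 2 := by rw [Real.sqrt_lt' (by norm_num)]; norm_num
  have hs0 : 0 < Real.sqrt 2 := Real.sqrt_pos.2 (by norm_num)
  have hslow : ∀ j : Fin 2, Real.sqrt 2 / 4 * 1 + max (Real.sqrt 2 / 4 * 1) 0 *
      (((fun _ => (1 : Polynomial ℂ)) j).natDegree : ℝ) < (X j : MvPolynomial (Fin 2) ℂ).totalDegree := by
    intro j
    rw [totalDegree_X]
    simp only [Polynomial.natDegree_one, Nat.cast_zero, mul_zero, add_zero, Nat.cast_one, mul_one]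
    linarith
  have hirr : Irrational (Real.sqrt 2 / 4) := irrational_sqrt_two.div_natCast (m := 4) (by norm_num)
  exact polyFibredGraph_equivariantDirection_member_dense _ (by rw [hdeg]) ![1, 1] (Real.sqrt 2 / 4)
    hirr hequiv _ hAinj hA 1 hlam (fun _ => 1) hslow

end Example

end Summit.Schanuel.Schanuel.Theorems

end
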